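import Literature.MathematicalPhysics.QuantumFieldTheory.Balaban1983to89.BlockAveragingFederbushGValued
import HarnessLib

/-!
# Route `UnitScaleTilt`, crux «MinimiserStabilityRegPr» (stmt-QuantumFields-19200), EX display footnote 17v — NEG-hPcol piece (N1):
# **THE (0.4) OPERATION `eml = exp[mean log]` OF AN INVERSION-PAIRED FAMILY IS `1`**

Cell `ym3-torus`, twin-width seat `ym-routeR-w2` (gen 11); ★★OWNER ym3-torus-plan g32 WORD 38 (2026-08-29T18:26:36Z «NEG-hPcol — GO, LOW PRIORITY»,
«routeR-w2 g11 has first refusal on (3)»; amendment 18:37:33Z: module names use `Neg`, not `Negative`) and px12 g11's NAMING LINE (18:30:32Z, «(N1) → routeR-w2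
g11», signature as named).  v2: the matrix helper `log h = −log g` is CITED from lit ✓`ExpMeanLog.mlog_eq_neg_of_mul_eq_one` (any complete normed ℂ-algebra)
instead of being restated (routeR-w3 g11 read 18:38:31Z), which also makes the inversion-pairing theorem algebra-general (§1); the matrix signature named by
px12 is kept verbatim (§2).  THEOREMS ONLY (0 `def`, 0 `sorry`, 0 `instance`); `--supports stmt-QuantumFields-19200 --as helper`, count-neutral.

WHY.  px12 g11's LOCATE d8153c1b ∕ 8aced68d (19200 evidence) shows that the EX display row `hPcol` of S42ᴸ (✓p729698 :185–188), AS DISPLAYED (before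
LIFT-THREAD 2's `Lift` antecedent), is not inhabitable: on the explicit «axis-per-direction, block-periodic commutator lattice» `U_s` the block averages are
trivial, `Ū_s ≡ 1`, although `U_s` is curved and irreducible.  The one structural step of `Ū_s ≡ 1` (LOCATE v2.1 (c′)) is that the (0.4) loop variables
come in inverse pairs under the involution `(n, σ, σ′) ↦ (n, σ′, σ)` of the index set, and that `exp[mean log]` of such a family is `1` because
`log h⁻¹ = −log h` near `1`.  This file is that step, abstractly (no lattice letters): §1 over any complete normed ℂ-algebra, §2 the matrix ∕ units forms
([Balaban1987RG1] (0.4) p.253 is the operation; the lemma is folklore).  px12 g11's (N3) applies it to `Prop8ChartDefs.emlAvgU`.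

WHAT THIS IS NOT: not a refutation of any registered item (`hPcol` is a display BINDER), not a display event, not progress on EX; YM₃ on T³ is ladder rung
R3 — NOT d = 4, NOT infinite volume, NOT a mass gap, NOT the Clay problem; nothing here is a claim about the stub, the crux or the gap.
References: T. Bałaban, CMP 109 (1987) 249–301 [Balaban1987RG1], (0.4) p.253; CMP 99 (1985) 389–434 [Balaban1985BackgroundPropagators] (the row (3.139)-type `hPcol`).
-/

open scoped BigOperators Matrix.Norms.L2Operator
open NormedSpace

namespace Summit.QuantumFields.YangMills.Theorems.Prop7HPcolNegEmlPairing

open Literature.MathematicalPhysics.QuantumFieldTheory.Balaban1983to89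
open Literature.MathematicalPhysics.QuantumFieldTheory.Balaban1983to89.ExpMeanLog (eml eml_eq_exp)
open MatrixLog (mlog)

/-! ## §1 Any complete normed ℂ-algebra -/

section Banach

variable {𝔸 : Type*} [NormedRing 𝔸] [NormedAlgebra ℂ 𝔸] {ι : Type*} [Fintype ι]

/-- If a permutation `τ` of the finite index set satisfies `log W_{τ i} = −log W_i` for every `i`, then `Σ_i log W_i = 0`
(reindex the sum by `τ`: it equals its own negative). [folklore] -/
theorem sum_mlog_eq_zero_of_pairing (τ : Equiv.Perm ι) (W : ι → 𝔸) (h : ∀ i, mlog (W (τ i)) = -mlog (W i)) :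
    ∑ i, mlog (W i) = 0 := by
  have hre : ∑ i, mlog (W (τ i)) = ∑ i, mlog (W i) := Equiv.sum_comp τ (fun i => mlog (W i))
  have hneg : ∑ i, mlog (W (τ i)) = -∑ i, mlog (W i) := by
    rw [← Finset.sum_neg_distrib]
    exact Finset.sum_congr rfl fun i _ => h i
  have h2 : (2 : ℂ) • ∑ i, mlog (W i) = 0 := by
    rw [two_smul]
    nth_rewrite 1 [← hre]
    rw [hneg, neg_add_cancel]
  exact (smul_eq_zero.mp h2).resolve_left two_ne_zero

/-- **`exp[mean log]` of a log-antisymmetrically paired family is `1`** ([Balaban1987RG1] (0.4)'s operation `eml W = exp(|I|⁻¹ Σ_i log W_i)`):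
the mean of the logarithms is `0`. [cite: Balaban1987RG1, (0.4) p.253] -/
theorem eml_eq_one_of_pairing (τ : Equiv.Perm ι) (W : ι → 𝔸) (h : ∀ i, mlog (W (τ i)) = -mlog (W i)) : eml W = 1 := by
  rw [eml_eq_exp, sum_mlog_eq_zero_of_pairing τ W h, smul_zero, exp_zero]

/-- The same with the pairing given as an involution of the index set (fixed points allowed: there `log W_i = −log W_i`). [cite: Balaban1987RG1, (0.4) p.253] -/
theorem eml_eq_one_of_involutive_pairing (τ : ι → ι) (hτ : Function.Involutive τ) (W : ι → 𝔸)
    (h : ∀ i, mlog (W (τ i)) = -mlog (W i)) : eml W = 1 :=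
  eml_eq_one_of_pairing (hτ.toPerm τ) W h

variable [CompleteSpace 𝔸]

/-- **`eml` OF AN INVERSION-PAIRED FAMILY IS `1`, in any complete normed ℂ-algebra**: an involution `τ` with `W_{τ i} · W_i = 1` and `‖W_i − 1‖ ≤ 1/3` for all
`i` (the log-antisymmetry is lit ✓`ExpMeanLog.mlog_eq_neg_of_mul_eq_one`, applied to `W_i · W_{τ i} = 1`, which is the hypothesis at `τ i`). [cite: Balaban1987RG1, (0.4) p.253] -/
theorem eml_eq_one_of_involutive_mul_eq_one (τ : ι → ι) (hτ : Function.Involutive τ) (W : ι → 𝔸) (hW : ∀ i, ‖W i - 1‖ ≤ 1 / 3)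
    (hinv : ∀ i, W (τ i) * W i = 1) : eml W = 1 :=
  eml_eq_one_of_involutive_pairing τ hτ W fun i =>
    ExpMeanLog.mlog_eq_neg_of_mul_eq_one (X := W i) (Y := W (τ i)) (by simpa only [hτ i] using hinv (τ i)) (hW i)

/-- Permutation form: `W_{τ i} · W_i = 1` for a pairing permutation whose square fixes the products (here: any `τ` with `W_i · W_{τ i} = 1` as well, e.g. when the
`W_i` are units — a left inverse of a unit is a right inverse). Stated with BOTH one-sided identities to stay free of invertibility bookkeeping. [cite: Balaban1987RG1, (0.4) p.253] -/
theorem eml_eq_one_of_mul_eq_one (τ : Equiv.Perm ι) (W : ι → 𝔸) (hW : ∀ i, ‖W i - 1‖ ≤ 1 / 3)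
    (hinv : ∀ i, W i * W (τ i) = 1) : eml W = 1 :=
  eml_eq_one_of_pairing τ W fun i => ExpMeanLog.mlog_eq_neg_of_mul_eq_one (hinv i) (hW i)

end Banach

/-! ## §2 Matrices and units (the shapes named by px12 g11 and used by `Prop8ChartDefs.loopHolU`) -/

section Matrices

variable {n : Type*} [Fintype n] [DecidableEq n] {ι : Type*} [Fintype ι]

/-- ★ **(N1) AS NAMED (px12 g11 2026-08-29T18:30:32Z): `eml` OF AN INVERSION-PAIRED MATRIX FAMILY IS `1`** — for an involution `τ` of the finite index
set with `W_{τ i} · W_i = 1` and `‖W_i − 1‖ ≤ 1/3` for all `i`, `exp[|I|⁻¹ Σ_i log W_i] = 1` (L2-operator norm, the instance of lit ✓`mlog_inv`). [cite: Balaban1987RG1, (0.4) p.253] -/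
theorem eml_eq_one_of_inv_pairing {N : ℕ} {ι : Type*} [Fintype ι] (τ : ι → ι) (hτ : Function.Involutive τ)
    (W : ι → Matrix (Fin N) (Fin N) ℂ) (hW : ∀ i, ‖W i - 1‖ ≤ 1 / 3) (hinv : ∀ i, W (τ i) * W i = 1) : eml W = 1 :=
  eml_eq_one_of_involutive_mul_eq_one τ hτ W hW hinv

/-- The same over any finite matrix size `n` and a pairing PERMUTATION (one-sided inverses of square matrices are two-sided: `mul_eq_one_comm`). [cite: Balaban1987RG1, (0.4) p.253] -/
theorem eml_eq_one_of_inv_pairing' (τ : Equiv.Perm ι) (W : ι → Matrix n n ℂ) (hW : ∀ i, ‖W i - 1‖ ≤ 1 / 3)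
    (hinv : ∀ i, W (τ i) * W i = 1) : eml W = 1 :=
  eml_eq_one_of_mul_eq_one τ W hW fun i => mul_eq_one_comm.mp (hinv i)

/-- **Units-valued form** (the shape of the (0.4) loop variables `Prop8ChartDefs.loopHolU U c : Idx P → 𝔸ˣ` inside ✓`coe_emlAvgU`): if `W_{τ i} = W_i⁻¹` in the
unit group and every `W_i` is within `1/3` of `1`, then `eml (i ↦ ↑(W i)) = 1`. [cite: Balaban1987RG1, (0.4) p.253] -/
theorem eml_coe_units_eq_one_of_inv_pairing (τ : Equiv.Perm ι) (W : ι → (Matrix n n ℂ)ˣ)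
    (hW : ∀ i, ‖(W i : Matrix n n ℂ) - 1‖ ≤ 1 / 3) (hinv : ∀ i, W (τ i) = (W i)⁻¹) :
    eml (fun i => (W i : Matrix n n ℂ)) = 1 :=
  eml_eq_one_of_mul_eq_one τ _ hW fun i => by
    rw [hinv i, ← Units.val_mul, mul_inv_cancel, Units.val_one]

/-- Units-valued form with an involution of the index set. [cite: Balaban1987RG1, (0.4) p.253] -/
theorem eml_coe_units_eq_one_of_involutive_inv_pairing (τ : ι → ι) (hτ : Function.Involutive τ) (W : ι → (Matrix n n ℂ)ˣ)
    (hW : ∀ i, ‖(W i : Matrix n n ℂ) - 1‖ ≤ 1 / 3) (hinv : ∀ i, W (τ i) = (W i)⁻¹) :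
    eml (fun i => (W i : Matrix n n ℂ)) = 1 :=
  eml_coe_units_eq_one_of_inv_pairing (hτ.toPerm τ) W hW hinv

end Matrices

end Summit.QuantumFields.YangMills.Theorems.Prop7HPcolNegEmlPairing
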